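import Summits.HodgeConjecture.CorCM.StabiliserOrbitSelfConjugateCMFields
import Literature.NumberTheory.ComplexMultiplication.ReflexCMType
import Literature.AlgebraicGeometry.Motives.ZarhinHodgeGroupAutC
import HarnessLib

/-!
# Self-conjugate stabiliser orbits read on a GALOIS MODEL: (SC) for `K` is a finite condition on `Gal(L/ℚ)` for any
# Galois CM field `L` receiving `K`

COR-CM (cell `pub-hodgecm2`, binder seat `b16` gen 54, count-neutral claim STAB-CONJ, file F7; theorems only, no definition,
no named fact, no `sorry`).  NEW as stated, hence under `Summits/`.  HONEST FRAMING: a bridge lemma between the `Aut(ℂ)`-form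
of the hypothesis (SC) of F1–F6 and a finite Galois group; `HC_CM` is neither used nor asserted.

The hypothesis of this chapter,

  (SC)  `∀ x₀ x : K → ℂ, x ∉ {x₀, x̄₀} → ∃ σ ∈ Aut(ℂ), σ ∘ x₀ = x₀ ∧ σ ∘ x = x̄`,

quantifies over `Aut(ℂ)`.  The census seats work with a Galois CM number field `L ⊇ K` (a normal closure, a cyclotomic
field, …) and a model of `Gal(L/ℚ)`.  Since every complex embedding of `K` factors as `ι ∘ g ∘ j` (`j : K → L`,
`ι : L → ℂ`, `g ∈ Gal(L/ℚ)`; `exists_algHom_comp_eq_of_normal`, `exists_algEquiv_smul_eq`), every automorphism of `L`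
extends to `ℂ` (`Aut(ℂ)` is transitive on the embeddings of the countable field `L`) and every automorphism of `ℂ`
restricts to the normal field `ι(L)`, and since complex conjugation of `ℂ` restricts to the complex conjugation `ρ_L` of
the CM field `L` under EVERY embedding, (SC) is equivalent to the FINITE condition

  (SC)_L  `∀ g ∈ Gal(L/ℚ), g∘j ∉ {j, ρ_L∘j} → ∃ h ∈ Gal(L/ℚ), h∘j = j ∧ h∘(g∘j) = ρ_L∘(g∘j)`

— with `H = Gal(L/j(K))`: every `g ∉ H ∪ ρ_L H` has some `h ∈ H` with `g⁻¹hg ∈ ρ_L H` — decidable on a group model.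

* **`stabConj_of_galois`** ((SC)_L ⟹ (SC)), **`galois_of_stabConj`** ((SC) ⟹ (SC)_L), **`stabConj_iff_galois`**;
* `isNondegenerate_of_galois`, `isSimple_of_galois`, `isNondegenerateFamily_iff_linearIndependent_of_galois` — the F2
  consequences from (SC)_L (e.g. for the `GL₂(𝔽₃)`-octics and the two order-`32` octic Galois types with sign group of
  order `4` found by the seat's census, once a Galois model is fixed);
* **`stabConj_of_groupModel`** — the same from a group model `e : Gal(L/ℚ) ≃* G₀` with `H₀ = e(Gal(L/j(K)))` and
  `c₀ = e(ρ_L)`: `∀ g₀ ∉ H₀ ∪ c₀H₀, ∃ h₀ ∈ H₀, g₀⁻¹c₀⁻¹h₀g₀ ∈ H₀` (a `decide` on a concrete `G₀`).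

## References

* [Shimura1998] G. Shimura, *Abelian Varieties with Complex Multiplication and Modular Functions*, §8.1 Prop. 25 (proof),
  §18.2 Lemma.
* [Lang2002] S. Lang, *Algebra*, 3rd ed., V §2 Thm. 2.8 (extension of embeddings), VI §1.
* [Wielandt1964] H. Wielandt, *Finite Permutation Groups* (1964), Thm. 28.4.
-/

set_option autoImplicit false

noncomputable section

open CategoryTheory CategoryTheory.Limits NumberField

namespace Summit.HodgeConjecture.CorCM

open Literature.NumberTheory.ComplexMultiplication
open Literature.AlgebraicGeometry.Motives (AbelianVariety CMType)
open Literature.AlgebraicGeometry.HodgeTheory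
open Literature.AlgebraicGeometry.ComplexMultiplication (IsCMTypeRealisation)
open Literature.AlgebraicGeometry.Pohlmann1968
open GenericCMField

variable {K : Type} [Field K] [NumberField K] [IsCMField K]
variable {L : Type} [Field L] [NumberField L]

/-! ## §1 Extension and restriction between `Gal(L/ℚ)` and `Aut(ℂ)` -/

section Bridge

/-- Every automorphism `h` of `L` extends along `ι` to an automorphism `σ` of `ℂ`: `σ ∘ ι = ι ∘ h` (`Aut(ℂ)` is transitive
on the embeddings of the countable field `L`). [cite: Lang2002, V §2 Thm. 2.8] -/
theorem exists_ringEquiv_comp_eq_comp_algEquiv₅₄ (ι : L →+* ℂ) (h : L ≃ₐ[ℚ] L) :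
    ∃ σ : ℂ ≃+* ℂ, ∀ a : L, σ (ι a) = ι (h a) := by
  haveI : Countable L := Countable.of_equiv _ (Module.finBasis ℚ L).equivFun.toEquiv.symm
  exact Literature.AlgebraicGeometry.Motives.ZarhinLie.exists_ringEquiv_complex_comp_eq ι (ι.comp (h : L →+* L))

/-- Every automorphism `σ` of `ℂ` restricts along `ι` to an automorphism `h` of the normal field `L`: `σ ∘ ι = ι ∘ h`.
[cite: Lang2002, VI §1] -/
theorem exists_algEquiv_comp_eq_ringEquiv_comp₅₄ [Normal ℚ L] (ι : L →+* ℂ) (σ : ℂ ≃+* ℂ) :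
    ∃ h : L ≃ₐ[ℚ] L, ∀ a : L, ι (h a) = σ (ι a) := by
  obtain ⟨ψ, hψ⟩ := exists_algHom_comp_eq_of_normal (AlgHom.id ℚ L) ι ((σ : ℂ →+* ℂ).comp ι)
  exact ⟨AlgEquiv.ofBijective ψ (Algebra.IsAlgebraic.algHom_bijective ψ), fun a => RingHom.congr_fun hψ a⟩

/-- Complex conjugation of `ℂ` restricts to `ρ_L` under every embedding of the CM field `L`.
[cite: Shimura1998, §18.2 Lemma] -/
theorem conj_apply_eq₅₄ [IsCMField L] (ι : L →+* ℂ) (a : L) : starRingAut (ι a) = ι (IsCMField.complexConj L a) := by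
  rw [starRingAut_apply, IsCMField.complexEmbedding_complexConj]
  rfl

end Bridge

/-! ## §2 (SC) ⟺ (SC)_L -/

section Model

variable [IsCMField L] [IsGalois ℚ L]

/-- **(SC)_L ⟹ (SC).**  `L` a Galois CM field, `j : K → L`, `ι : L → ℂ`.  If for every `g ∈ Gal(L/ℚ)` with
`g ∘ j ∉ {j, ρ_L ∘ j}` some `h ∈ Gal(L/ℚ)` fixes `j` and conjugates `g ∘ j` (`h ∘ j = j`, `h ∘ g ∘ j = ρ_L ∘ g ∘ j`), then
`K` satisfies (SC): every CM type of `K` is nondegenerate, etc. (F1–F6).  [cite: Shimura1998, §8.1 Prop. 25 (proof)]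
[cite: Wielandt1964, Thm. 28.4] -/
theorem stabConj_of_galois (ι : L →+* ℂ) (j : K →ₐ[ℚ] L)
    (hG : ∀ g : L ≃ₐ[ℚ] L, (∃ w, g (j w) ≠ j w) → (∃ w, g (j w) ≠ IsCMField.complexConj L (j w)) →
      ∃ h : L ≃ₐ[ℚ] L, (∀ w, h (j w) = j w) ∧ ∀ w, h (g (j w)) = IsCMField.complexConj L (g (j w)))
    (x₀ x : K →+* ℂ) (hx : x ≠ x₀) (hx' : x ≠ (starRingAut : ℂ ≃+* ℂ) • x₀) :
    ∃ σ : ℂ ≃+* ℂ, σ • x₀ = x₀ ∧ σ • x = (starRingAut : ℂ ≃+* ℂ) • x := by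
  -- one base point suffices: `x₁ = ι ∘ j`
  refine stabConj_of_stabConj_at (x₀ := ι.comp (j : K →+* L)) (fun y hy hy' => ?_) x₀ x hx hx'
  obtain ⟨ψ, hψ⟩ := exists_algHom_comp_eq_of_normal j ι y
  obtain ⟨g, hg⟩ := exists_algEquiv_smul_eq j ψ
  have hyw : ∀ w, y w = ι (g (j w)) := fun w => by
    rw [← hψ, RingHom.comp_apply, ← hg]
    rfl
  have h1 : ∃ w, g (j w) ≠ j w := by
    by_contra hno
    apply hy
    refine RingHom.ext fun w => ?_
    rw [hyw, RingHom.comp_apply]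
    by_contra hne
    exact hno ⟨w, fun h => hne (by rw [h]; rfl)⟩
  have h2 : ∃ w, g (j w) ≠ IsCMField.complexConj L (j w) := by
    by_contra hno
    apply hy'
    refine RingHom.ext fun w => ?_
    rw [hyw, ringEquiv_smul_apply, RingHom.comp_apply]
    by_contra hne
    refine hno ⟨w, fun h => hne ?_⟩
    rw [h, ← conj_apply_eq₅₄]
    rfl
  obtain ⟨h, hj, hgj⟩ := hG g h1 h2
  obtain ⟨σ, hσ⟩ := exists_ringEquiv_comp_eq_comp_algEquiv₅₄ ι h
  refine ⟨σ, RingHom.ext fun w => ?_, RingHom.ext fun w => ?_⟩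
  · rw [ringEquiv_smul_apply, RingHom.comp_apply]
    change σ (ι (j w)) = ι (j w)
    rw [hσ, hj]
  · rw [ringEquiv_smul_apply, ringEquiv_smul_apply, hyw, hσ, hgj, conj_apply_eq₅₄]

omit [IsCMField K] in
/-- **(SC) ⟹ (SC)_L**: conversely (SC) for `K` forces the finite condition on `Gal(L/ℚ)` (restrict the automorphism of
`ℂ` to the normal field `ι(L)`). [cite: Shimura1998, §8.1 Prop. 25 (proof)] [cite: Lang2002, VI §1] -/
theorem galois_of_stabConj (ι : L →+* ℂ) (j : K →ₐ[ℚ] L)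
    (hSC : ∀ x₀ x : K →+* ℂ, x ≠ x₀ → x ≠ (starRingAut : ℂ ≃+* ℂ) • x₀ →
      ∃ σ : ℂ ≃+* ℂ, σ • x₀ = x₀ ∧ σ • x = (starRingAut : ℂ ≃+* ℂ) • x)
    (g : L ≃ₐ[ℚ] L) (h1 : ∃ w, g (j w) ≠ j w) (h2 : ∃ w, g (j w) ≠ IsCMField.complexConj L (j w)) :
    ∃ h : L ≃ₐ[ℚ] L, (∀ w, h (j w) = j w) ∧ ∀ w, h (g (j w)) = IsCMField.complexConj L (g (j w)) := by
  set x₀ : K →+* ℂ := ι.comp (j : K →+* L) with hx₀_def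
  set x : K →+* ℂ := (ι.comp (g : L →+* L)).comp (j : K →+* L) with hx_def
  have hx₀w : ∀ w, x₀ w = ι (j w) := fun w => rfl
  have hxw : ∀ w, x w = ι (g (j w)) := fun w => rfl
  have hx : x ≠ x₀ := by
    obtain ⟨w, hw⟩ := h1
    intro h
    exact hw (ι.injective (by rw [← hxw, ← hx₀w, h]))
  have hx' : x ≠ (starRingAut : ℂ ≃+* ℂ) • x₀ := by
    obtain ⟨w, hw⟩ := h2
    intro h
    apply hw
    apply ι.injective
    rw [← hxw, h, ringEquiv_smul_apply, hx₀w, conj_apply_eq₅₄]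
  obtain ⟨σ, hσ₀, hσx⟩ := hSC x₀ x hx hx'
  obtain ⟨h, hh⟩ := exists_algEquiv_comp_eq_ringEquiv_comp₅₄ ι σ
  refine ⟨h, fun w => ι.injective ?_, fun w => ι.injective ?_⟩
  · rw [hh, ← hx₀w, ← ringEquiv_smul_apply σ x₀ w, hσ₀]
  · rw [hh, ← hxw, ← ringEquiv_smul_apply σ x w, hσx, ringEquiv_smul_apply, hxw, conj_apply_eq₅₄]

/-- **(SC) ⟺ (SC)_L** for any Galois CM field `L` receiving `K`. [cite: Shimura1998, §8.1 Prop. 25 (proof)]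
[cite: Wielandt1964, Thm. 28.4] -/
theorem stabConj_iff_galois (ι : L →+* ℂ) (j : K →ₐ[ℚ] L) :
    (∀ x₀ x : K →+* ℂ, x ≠ x₀ → x ≠ (starRingAut : ℂ ≃+* ℂ) • x₀ →
      ∃ σ : ℂ ≃+* ℂ, σ • x₀ = x₀ ∧ σ • x = (starRingAut : ℂ ≃+* ℂ) • x) ↔
    ∀ g : L ≃ₐ[ℚ] L, (∃ w, g (j w) ≠ j w) → (∃ w, g (j w) ≠ IsCMField.complexConj L (j w)) →
      ∃ h : L ≃ₐ[ℚ] L, (∀ w, h (j w) = j w) ∧ ∀ w, h (g (j w)) = IsCMField.complexConj L (g (j w)) :=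
  ⟨fun hSC g h1 h2 => galois_of_stabConj ι j hSC g h1 h2, fun hG => stabConj_of_galois ι j hG⟩

end Model

/-! ## §3 Consequences from the Galois model -/

section Consequences

variable [IsCMField L] [IsGalois ℚ L]

/-- **(SC)_L ⟹ every CM type of `K` is nondegenerate.** [cite: Shimura1998, §8.2 Prop. 26] [cite: Wielandt1964, Thm. 28.4] -/
theorem isNondegenerate_of_galois (ι : L →+* ℂ) (j : K →ₐ[ℚ] L)
    (hG : ∀ g : L ≃ₐ[ℚ] L, (∃ w, g (j w) ≠ j w) → (∃ w, g (j w) ≠ IsCMField.complexConj L (j w)) →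
      ∃ h : L ≃ₐ[ℚ] L, (∀ w, h (j w) = j w) ∧ ∀ w, h (g (j w)) = IsCMField.complexConj L (g (j w)))
    (Φ : CMType K) : IsNondegenerate Φ :=
  isNondegenerate_of_stabConj (stabConj_of_galois ι j hG) Φ

/-- **(SC)_L ⟹ every abelian variety with CM by `K` is simple.** [cite: Shimura1998, §8.2 Prop. 26] -/
theorem isSimple_of_galois (ι : L →+* ℂ) (j : K →ₐ[ℚ] L)
    (hG : ∀ g : L ≃ₐ[ℚ] L, (∃ w, g (j w) ≠ j w) → (∃ w, g (j w) ≠ IsCMField.complexConj L (j w)) →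
      ∃ h : L ≃ₐ[ℚ] L, (∀ w, h (j w) = j w) ∧ ∀ w, h (g (j w)) = IsCMField.complexConj L (g (j w)))
    {Φ : CMType K} {A : AbelianVariety ℂ} {ι' : 𝓞 K →+* End A} {θ : K →+* Module.End ℂ (complexBetti A.X 1)}
    (hA : IsCMTypeRealisation Φ A ι' θ) : A.IsSimple :=
  isSimple_of_stabConj (stabConj_of_galois ι j hG) hA

/-- **(SC)_L ⟹ families of types of `K` are decided by their type vectors.** [cite: Wielandt1964, Thm. 28.4] -/
theorem isNondegenerateFamily_iff_linearIndependent_of_galois (ι : L →+* ℂ) (j : K →ₐ[ℚ] L)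
    (hG : ∀ g : L ≃ₐ[ℚ] L, (∃ w, g (j w) ≠ j w) → (∃ w, g (j w) ≠ IsCMField.complexConj L (j w)) →
      ∃ h : L ≃ₐ[ℚ] L, (∀ w, h (j w) = j w) ∧ ∀ w, h (g (j w)) = IsCMField.complexConj L (g (j w)))
    {I : Type} [Fintype I] [Nonempty I] (Φ : I → CMType K) :
    CMAlgebra.IsNondegenerateFamily (K := fun _ : I => K) Φ ↔
      LinearIndependent ℚ fun i => antiVec (Φ i).1 (1 : ℂ ≃+* ℂ) :=
  isNondegenerateFamily_iff_linearIndependent_of_stabConj (stabConj_of_galois ι j hG) Φ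

end Consequences

/-! ## §4 On a group model `e : Gal(L/ℚ) ≃* G₀` -/

section GroupModel

variable [IsCMField L] [IsGalois ℚ L]

/-- **(SC) from a GROUP MODEL.**  `e : Gal(L/ℚ) ≃* G₀`, `H₀ ⊆ G₀` the image of `Gal(L/j(K))` (the elements fixing `j`
pointwise), `c₀` the image of complex conjugation `ρ_L`.  If every `g₀ ∉ H₀` with `c₀⁻¹ g₀ ∉ H₀` admits `h₀ ∈ H₀` with
`g₀⁻¹ c₀⁻¹ h₀ g₀ ∈ H₀` — a finite check, `decide` on a concrete `G₀` — then `K` satisfies (SC).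
[cite: Wielandt1964, Thm. 28.4] [cite: Shimura1998, §8.1 Prop. 25 (proof)] -/
theorem stabConj_of_groupModel {G₀ : Type} [Group G₀] (e : (L ≃ₐ[ℚ] L) ≃* G₀) (ι : L →+* ℂ) (j : K →ₐ[ℚ] L)
    (H₀ : Set G₀) (hH₀ : ∀ h : L ≃ₐ[ℚ] L, e h ∈ H₀ ↔ ∀ w, h (j w) = j w)
    (c₀ : G₀) (hc₀ : ∀ a : L, e.symm c₀ a = IsCMField.complexConj L a)
    (hG₀ : ∀ g₀ : G₀, g₀ ∉ H₀ → c₀⁻¹ * g₀ ∉ H₀ → ∃ h₀ ∈ H₀, g₀⁻¹ * c₀⁻¹ * h₀ * g₀ ∈ H₀)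
    (x₀ x : K →+* ℂ) (hx : x ≠ x₀) (hx' : x ≠ (starRingAut : ℂ ≃+* ℂ) • x₀) :
    ∃ σ : ℂ ≃+* ℂ, σ • x₀ = x₀ ∧ σ • x = (starRingAut : ℂ ≃+* ℂ) • x := by
  refine stabConj_of_galois ι j (fun g h1 h2 => ?_) x₀ x hx hx'
  set c : L ≃ₐ[ℚ] L := e.symm c₀ with hc_def
  have hec : e c = c₀ := by rw [hc_def, MulEquiv.apply_symm_apply]
  -- `g ∉ H₀`
  have hg : e g ∉ H₀ := fun hmem => by
    obtain ⟨w, hw⟩ := h1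
    exact hw ((hH₀ g).1 hmem w)
  -- `c₀⁻¹ g ∉ H₀`: else `g ∘ j = ρ_L ∘ j`
  have hcg : c₀⁻¹ * e g ∉ H₀ := fun hmem => by
    obtain ⟨w, hw⟩ := h2
    have hmem' : e (c⁻¹ * g) ∈ H₀ := by rwa [map_mul, map_inv, hec]
    have h3 := (hH₀ (c⁻¹ * g)).1 hmem' w
    rw [AlgEquiv.mul_apply, AlgEquiv.aut_inv, AlgEquiv.symm_apply_eq] at h3
    exact hw (h3.trans (hc₀ (j w)))
  obtain ⟨h₀, hh₀, hconj⟩ := hG₀ (e g) hg hcg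
  refine ⟨e.symm h₀, fun w => (hH₀ (e.symm h₀)).1 (by rwa [MulEquiv.apply_symm_apply]) w, fun w => ?_⟩
  -- `g⁻¹ c⁻¹ h g` fixes `j`, i.e. `h (g (j w)) = c (g (j w))`
  have hmem : e (g⁻¹ * c⁻¹ * e.symm h₀ * g) ∈ H₀ := by
    rwa [map_mul, map_mul, map_mul, map_inv, map_inv, hec, MulEquiv.apply_symm_apply]
  have h4 := (hH₀ _).1 hmem w
  rw [AlgEquiv.mul_apply, AlgEquiv.mul_apply, AlgEquiv.mul_apply, AlgEquiv.aut_inv, AlgEquiv.aut_inv,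
    AlgEquiv.symm_apply_eq, AlgEquiv.symm_apply_eq] at h4
  rw [h4, hc₀]

end GroupModel

end Summit.HodgeConjecture.CorCM

end
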